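import Literature.Analysis.FluidPDE.PassiveScalarEnergyDecay
import HarnessLib

/-!
# Crux `SelfMixingDichotomy.CoherentScaleExclusion` (stmt-NavierStokesRegularity-1423), line
  `registered`: tools for STUB K `stub_passiveScalarL1Antitone` (Kato's `L¹` contraction)

Helper file (theorems only; lands `--supports stmt-NavierStokesRegularity-1423`) for the
registered stub `stub_passiveScalarL1Antitone` of the lead's skeleton
`Cruxes/CoherentScaleExclusion/Lines/birth.lean` (reshape r2), proved in
`SelfMixingDichotomyCoherentScaleExclusionPassiveScalarL1Antitone.lean`:
the `L¹` norm of a smooth rapidly decaying passive scalar in a `C¹` divergence-free `L²` drift is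
nonincreasing. This file supplies the three `ε`-independent ingredients of Kato's argument:

* the calculus of Kato's regularised modulus `φ_ε(s) = √(s² + ε²) − ε` (section `Kato`):
  `|φ_ε(s)| ≤ |s|`, `φ_ε' (s) = s/√(s² + ε²)`, `|φ_ε'| ≤ 1`,
  `φ_ε''(s) = ε²/((s² + ε²)√(s² + ε²)) ∈ [0, ε⁻¹]`, `φ_ε''` continuous, `φ_{1/(n+1)}(s) → |s|`;
* `integral_fderiv_apply_eq_zero_of_decay_of_memLp`: **the transport pairing vanishes**,
  `∫ DG(x)(v x) dx = 0` for a `C¹` divergence-free `v ∈ L²(E)` (no decay of `v`) and a `C¹` scalar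
  `G` decaying with its derivative like `(1 + ‖x‖)^{-r}`, `dim E < r` (the cutoff argument of the
  tree's `integral_mul_inner_gradient_eq_zero_of_memLp`, `DecayingScalarIntegrationByParts`, run
  for a general `G` in place of `θ²`);
* `integral_deriv_comp_mul_laplacian_nonpos`: **the dissipation pairing is nonpositive**,
  `∫ g(θ) Δθ = −∑ᵢ ∫ g'(θ) (∂ᵢθ)² ≤ 0` for a `C²` scalar `θ` decaying with two derivatives and a
  `C¹` function `g` with `|g| ≤ 1`, `0 ≤ g' ≤ M` (whole-space integration by parts in an
  orthonormal frame, Mathlib's `integral_bilinear_hasFDerivAt_right_eq_neg_left_of_integrable`).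

Everything in namespace `PassiveScalarL1` holds on a finite-dimensional real inner product space
`E`; the registered tools sub-goal `kaux_transportPairingVanishes` is the `ℝ³` instance of the
transport identity. Everything is proved, no definition, no named fact. References: T. Kato,
Israel J. Math. 13 (1972) (Kato's inequality); P. Constantin, A. Kiselev, L. Ryzhik, A. Zlatoš,
Ann. of Math. 168 (2008), §1.
-/

noncomputable section

open MeasureTheory Set Function Filter Topology InnerProductSpace
open scoped ContDiff Laplacian InnerProductSpace RealInnerProductSpace

-- `Summit = Problem` for this summit; the tree lakefile sets `weak.linter.dupNamespace = false`.
set_option linter.dupNamespace false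

namespace Summit.NavierStokesRegularity.NavierStokesRegularity.Theorems

open Literature.Analysis.FluidPDE

namespace PassiveScalarL1

/-! ### Kato's regularised modulus `φ_ε(s) = √(s² + ε²) − ε` -/

section Kato

variable {ε : ℝ}

/-- `ε ≤ √(s² + ε²)` for `ε ≥ 0`. -/
theorem le_sqrt_sq_add_sq (hε : 0 ≤ ε) (s : ℝ) : ε ≤ Real.sqrt (s ^ 2 + ε ^ 2) := by
  calc ε = Real.sqrt (ε ^ 2) := (Real.sqrt_sq hε).symm
    _ ≤ Real.sqrt (s ^ 2 + ε ^ 2) := Real.sqrt_le_sqrt (by nlinarith [sq_nonneg s])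

/-- `|s| ≤ √(s² + ε²)`. -/
theorem abs_le_sqrt_sq_add_sq (ε s : ℝ) : |s| ≤ Real.sqrt (s ^ 2 + ε ^ 2) :=
  Real.abs_le_sqrt (by nlinarith [sq_nonneg ε])

/-- `√(s² + ε²) ≤ |s| + ε` for `ε ≥ 0`. -/
theorem sqrt_sq_add_sq_le (hε : 0 ≤ ε) (s : ℝ) : Real.sqrt (s ^ 2 + ε ^ 2) ≤ |s| + ε := by
  rw [Real.sqrt_le_left (by positivity)]
  nlinarith [abs_nonneg s, sq_abs s]

/-- `0 < √(s² + ε²)` for `ε > 0`. -/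
theorem sqrt_sq_add_sq_pos (hε : 0 < ε) (s : ℝ) : 0 < Real.sqrt (s ^ 2 + ε ^ 2) :=
  hε.trans_le (le_sqrt_sq_add_sq hε.le s)

/-- `|φ_ε(s)| ≤ |s|`: the regularised modulus is dominated by the modulus (`ε ≥ 0`). -/
theorem abs_kato_le (hε : 0 ≤ ε) (s : ℝ) : |Real.sqrt (s ^ 2 + ε ^ 2) - ε| ≤ |s| := by
  rw [abs_of_nonneg (sub_nonneg.2 (le_sqrt_sq_add_sq hε s)), sub_le_iff_le_add]
  exact sqrt_sq_add_sq_le hε s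

/-- `φ_ε'(s) = s / √(s² + ε²)` (`ε > 0`). -/
theorem hasDerivAt_kato (hε : 0 < ε) (s : ℝ) :
    HasDerivAt (fun σ => Real.sqrt (σ ^ 2 + ε ^ 2) - ε) (s / Real.sqrt (s ^ 2 + ε ^ 2)) s := by
  have h1 : HasDerivAt (fun σ : ℝ => σ ^ 2 + ε ^ 2) (2 * s) s := by
    simpa using (hasDerivAt_pow 2 s).add_const (ε ^ 2)
  have h2 := (h1.sqrt (by positivity)).sub_const ε
  refine h2.congr_deriv ?_
  rw [mul_div_mul_left _ _ (two_ne_zero' ℝ)]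

/-- `φ_ε''(s) = ε² / ((s² + ε²) √(s² + ε²))` (`ε > 0`). -/
theorem hasDerivAt_katoDeriv (hε : 0 < ε) (s : ℝ) :
    HasDerivAt (fun σ => σ / Real.sqrt (σ ^ 2 + ε ^ 2))
      (ε ^ 2 / ((s ^ 2 + ε ^ 2) * Real.sqrt (s ^ 2 + ε ^ 2))) s := by
  have hpos : 0 < s ^ 2 + ε ^ 2 := by positivity
  have hR : 0 < Real.sqrt (s ^ 2 + ε ^ 2) := sqrt_sq_add_sq_pos hε s
  have h1 : HasDerivAt (fun σ : ℝ => σ ^ 2 + ε ^ 2) (2 * s) s := by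
    simpa using (hasDerivAt_pow 2 s).add_const (ε ^ 2)
  have h2 := (hasDerivAt_id' s).div (h1.sqrt hpos.ne') hR.ne'
  refine h2.congr_deriv ?_
  have hsq : Real.sqrt (s ^ 2 + ε ^ 2) ^ 2 = s ^ 2 + ε ^ 2 := Real.sq_sqrt hpos.le
  rw [mul_div_mul_left _ _ (two_ne_zero' ℝ), hsq, div_eq_div_iff hpos.ne' (by positivity)]
  field_simp
  nlinarith [hsq]

/-- `|φ_ε'(s)| ≤ 1` (`ε > 0`). -/
theorem abs_katoDeriv_le (hε : 0 < ε) (s : ℝ) : |s / Real.sqrt (s ^ 2 + ε ^ 2)| ≤ 1 := by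
  rw [abs_div, abs_of_pos (sqrt_sq_add_sq_pos hε s), div_le_one (sqrt_sq_add_sq_pos hε s)]
  exact abs_le_sqrt_sq_add_sq ε s

/-- `0 ≤ φ_ε''(s)`: the regularised modulus is convex. -/
theorem katoDeriv2_nonneg (ε s : ℝ) :
    0 ≤ ε ^ 2 / ((s ^ 2 + ε ^ 2) * Real.sqrt (s ^ 2 + ε ^ 2)) := by
  positivity

/-- `φ_ε''(s) ≤ ε⁻¹` (`ε > 0`). -/
theorem katoDeriv2_le (hε : 0 < ε) (s : ℝ) :
    ε ^ 2 / ((s ^ 2 + ε ^ 2) * Real.sqrt (s ^ 2 + ε ^ 2)) ≤ ε⁻¹ := by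
  have hden : ε ^ 2 * ε ≤ (s ^ 2 + ε ^ 2) * Real.sqrt (s ^ 2 + ε ^ 2) :=
    mul_le_mul (by nlinarith [sq_nonneg s]) (le_sqrt_sq_add_sq hε.le s) hε.le (by positivity)
  calc ε ^ 2 / ((s ^ 2 + ε ^ 2) * Real.sqrt (s ^ 2 + ε ^ 2)) ≤ ε ^ 2 / (ε ^ 2 * ε) :=
        div_le_div_of_nonneg_left (by positivity) (by positivity) hden
    _ = ε⁻¹ := by field_simp

/-- `φ_ε''` is continuous (`ε > 0`). -/
theorem continuous_katoDeriv2 (hε : 0 < ε) :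
    Continuous fun s : ℝ => ε ^ 2 / ((s ^ 2 + ε ^ 2) * Real.sqrt (s ^ 2 + ε ^ 2)) :=
  continuous_const.div (by fun_prop)
    fun s => (mul_pos (by positivity) (sqrt_sq_add_sq_pos hε s)).ne'

/-- `φ_{1/(n+1)}(s) → |s|` as `n → ∞`. -/
theorem tendsto_kato_abs (s : ℝ) :
    Tendsto (fun n : ℕ => Real.sqrt (s ^ 2 + (1 / ((n : ℝ) + 1)) ^ 2) - 1 / ((n : ℝ) + 1))
      atTop (𝓝 |s|) := by
  have hc : Continuous fun ε : ℝ => Real.sqrt (s ^ 2 + ε ^ 2) - ε := by fun_prop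
  have h0 : Real.sqrt (s ^ 2 + (0 : ℝ) ^ 2) - 0 = |s| := by simp [Real.sqrt_sq_eq_abs]
  have h := hc.tendsto 0
  rw [h0] at h
  exact h.comp tendsto_one_div_add_atTop_nhds_zero_nat

end Kato

/-! ### Whole-space integrations by parts -/

section General

variable {E : Type*} [NormedAddCommGroup E] [InnerProductSpace ℝ E] [FiniteDimensional ℝ E]
  [MeasurableSpace E] [BorelSpace E]

/-- **The transport pairing vanishes for an `L²` divergence-free drift (general scalar).** For a
`C¹` divergence-free field `v ∈ L²(E)` (no decay of `v` or `Dv`) and a `C¹` scalar `G` decaying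
with its derivative like `(1 + ‖x‖)^{-r}`, `dim E < r`: `∫ DG(x)(v x) dx = 0`. Proof: cut off with
the cutoffs `χₙ` of `exists_cutoff_seq`, integrate by parts with compact support
(`integral_fderiv_apply_eq_zero_of_hasCompactSupport`: `∫ D(χₙ G)(v) = 0`), and let `n → ∞` by
dominated convergence: `|χₙ DG(v) + G Dχₙ(v)| ≤ (1 + A) C w ‖v‖ ≤ (1 + A) C (w + ‖v‖²)`,
`w = (1 + ‖x‖)^{-r}`, an integrable bound, while `D(χₙ G)(x) = DG(x)` as soon as `‖x‖ < n + 1`. -/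
theorem integral_fderiv_apply_eq_zero_of_decay_of_memLp
    {v : E → E} {G : E → ℝ} (hv1 : ContDiff ℝ 1 v) (hdiv : VectorCalculus.IsDivFree v)
    (hv2 : MemLp v 2 (volume : Measure E))
    (hG1 : ContDiff ℝ 1 G) {C r : ℝ} (hC : 0 ≤ C) (hr : (Module.finrank ℝ E : ℝ) < r)
    (h0 : ∀ x, ‖G x‖ ≤ C * (1 + ‖x‖) ^ (-r)) (h1 : ∀ x, ‖fderiv ℝ G x‖ ≤ C * (1 + ‖x‖) ^ (-r)) :
    ∫ x, fderiv ℝ G x (v x) = 0 := by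
  obtain ⟨χ, A, hA0, hχ1, hχs, hχb, hDχb, hχ1n⟩ := exists_cutoff_seq (E := E)
  have hvc : Continuous v := hv1.continuous
  have hGd : ∀ x, HasFDerivAt G (fderiv ℝ G x) x := fun x =>
    (hG1.differentiable one_ne_zero x).hasFDerivAt
  have hr0 : 0 ≤ r := (Nat.cast_nonneg _).trans hr.le
  -- the truncated functions `ψₙ = χₙ G` and the integrands
  set ψ : ℕ → E → ℝ := fun n x => χ n x * G x with hψ_def
  have hψ1 : ∀ n, ContDiff ℝ 1 (ψ n) := fun n => (hχ1 n).mul hG1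
  have hψs : ∀ n, HasCompactSupport (ψ n) := fun n => (hχs n).mul_right
  have hψd : ∀ n x, HasFDerivAt (ψ n) (χ n x • fderiv ℝ G x + G x • fderiv ℝ (χ n) x) x :=
    fun n x => ((hχ1 n).differentiable one_ne_zero x).hasFDerivAt.fun_mul (hGd x)
  set F : ℕ → E → ℝ := fun n x => fderiv ℝ (ψ n) x (v x) with hF_def
  have hF0 : ∀ n, ∫ x, F n x = 0 := fun n =>
    integral_fderiv_apply_eq_zero_of_hasCompactSupport hv1 hdiv (hψ1 n) (hψs n)
  -- domination by `K ((1 + ‖x‖)^{-r} + ‖v x‖²)`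
  set K : ℝ := (1 + A) * C with hK_def
  set bound : E → ℝ := fun x => K * ((1 + ‖x‖) ^ (-r) + ‖v x‖ ^ 2) with hbound_def
  have hv2' : Integrable (fun x => ‖v x‖ ^ 2) (volume : Measure E) :=
    (memLp_two_iff_integrable_sq_norm hv2.1).1 hv2
  have hbound : Integrable bound (volume : Measure E) :=
    ((integrable_one_add_norm hr).add hv2').const_mul K
  have hFle : ∀ n x, ‖F n x‖ ≤ bound x := by
    intro n x
    set w : ℝ := (1 + ‖x‖) ^ (-r) with hw_def
    have hw0 : 0 ≤ w := Real.rpow_nonneg (by positivity) _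
    have hw1 : w ≤ 1 := rpow_neg_le_one x hr0
    have hGw : |G x| ≤ C * w := by simpa [Real.norm_eq_abs] using h0 x
    have hDGv : |fderiv ℝ G x (v x)| ≤ C * w * ‖v x‖ := by
      rw [← Real.norm_eq_abs]
      exact (ContinuousLinearMap.le_opNorm _ _).trans
        (mul_le_mul_of_nonneg_right (h1 x) (norm_nonneg _))
    have hDχv : |fderiv ℝ (χ n) x (v x)| ≤ A * ‖v x‖ := by
      rw [← Real.norm_eq_abs]
      exact (ContinuousLinearMap.le_opNorm _ _).trans
        (mul_le_mul_of_nonneg_right (hDχb n x) (norm_nonneg _))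
    have hχx : |χ n x| ≤ 1 := hχb n x
    have e : F n x = χ n x * fderiv ℝ G x (v x) + G x * fderiv ℝ (χ n) x (v x) := by
      simp only [hF_def, (hψd n x).fderiv, add_apply, smul_apply, smul_eq_mul]
    rw [e, Real.norm_eq_abs, hbound_def, hK_def]
    calc |χ n x * fderiv ℝ G x (v x) + G x * fderiv ℝ (χ n) x (v x)|
        ≤ |χ n x| * |fderiv ℝ G x (v x)| + |G x| * |fderiv ℝ (χ n) x (v x)| := by
          refine (abs_add_le _ _).trans (le_of_eq ?_)
          rw [abs_mul, abs_mul]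
      _ ≤ 1 * (C * w * ‖v x‖) + C * w * (A * ‖v x‖) := by gcongr
      _ = (1 + A) * C * (w * ‖v x‖) := by ring
      _ ≤ (1 + A) * C * (w + ‖v x‖ ^ 2) := by
          gcongr
          nlinarith [mul_nonneg hw0 (sub_nonneg.2 hw1), sq_nonneg (w - ‖v x‖ / 2),
            sq_nonneg ‖v x‖, norm_nonneg (v x)]
  -- pointwise convergence: `Fₙ x = DG(x)(v x)` as soon as `‖x‖ < n + 1`
  have hlim : ∀ x, Tendsto (fun n => F n x) atTop (𝓝 (fderiv ℝ G x (v x))) := by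
    intro x
    refine tendsto_const_nhds.congr' ?_
    filter_upwards [eventually_ge_atTop ⌈‖x‖⌉₊] with n hn
    have hxn : ‖x‖ < n + 1 := by
      have h1 : ‖x‖ ≤ (⌈‖x‖⌉₊ : ℝ) := Nat.le_ceil _
      have h2 : (⌈‖x‖⌉₊ : ℝ) ≤ n := by exact_mod_cast hn
      linarith
    have hev : ψ n =ᶠ[𝓝 x] G := by
      filter_upwards [hχ1n n x hxn] with y hy
      simp [hψ_def, hy]
    simp only [hF_def, hev.fderiv_eq]
  -- dominated convergence: `0 = ∫ Fₙ → ∫ DG(v)`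
  have hT := tendsto_integral_of_dominated_convergence bound
    (fun n => (((hψ1 n).continuous_fderiv one_ne_zero).clm_apply hvc).aestronglyMeasurable)
    hbound (fun n => Eventually.of_forall (hFle n)) (Eventually.of_forall hlim)
  have : Tendsto (fun _ : ℕ => (0 : ℝ)) atTop (𝓝 (∫ x, fderiv ℝ G x (v x))) :=
    hT.congr fun n => hF0 n
  exact (tendsto_const_nhds_iff.1 this).symm

/-- **Dissipation pairing for a convex function of a decaying scalar.** For a `C²` scalar `θ`
whose first two derivatives decay like `(1 + ‖x‖)^{-r}`, `dim E < r`, and a `C¹` function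
`g : ℝ → ℝ` with `|g| ≤ 1` and `0 ≤ g' ≤ M` continuous (think `g = Φ'` for a convex `Φ` with
bounded `Φ''`): `∫ g(θ) Δθ = −∑ᵢ ∫ g'(θ) (∂ᵢθ)² ≤ 0` (integration by parts of `g ∘ θ` against
`∂ᵢ∂ᵢθ` in an orthonormal frame, no boundary terms: the three products
`∂ᵢ∂ᵢθ · g(θ)`, `∂ᵢθ · g'(θ) ∂ᵢθ`, `∂ᵢθ · g(θ)` are integrable by decay). -/
theorem integral_deriv_comp_mul_laplacian_nonpos {θ : E → ℝ} (hθ2 : ContDiff ℝ 2 θ)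
    {C r : ℝ} (hC : 0 ≤ C) (hr : (Module.finrank ℝ E : ℝ) < r)
    (h1 : ∀ x, ‖fderiv ℝ θ x‖ ≤ C * (1 + ‖x‖) ^ (-r))
    (h2 : ∀ x, ‖fderiv ℝ (fderiv ℝ θ) x‖ ≤ C * (1 + ‖x‖) ^ (-r))
    {g g' : ℝ → ℝ} {M : ℝ} (hg : ∀ s, HasDerivAt g (g' s) s) (hg1 : ∀ s, |g s| ≤ 1)
    (hg'0 : ∀ s, 0 ≤ g' s) (hg'M : ∀ s, g' s ≤ M) (hg'c : Continuous g') :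
    ∫ x, g (θ x) * (Δ θ) x ≤ 0 := by
  set b := stdOrthonormalBasis ℝ E
  have hθc : Continuous θ := hθ2.continuous
  have hDθc : Continuous (fderiv ℝ θ) := hθ2.continuous_fderiv two_ne_zero
  have hD2 : ContDiff ℝ 1 (fderiv ℝ θ) := hθ2.fderiv_right (m := 1) (by norm_num)
  have hD2c : Continuous (fderiv ℝ (fderiv ℝ θ)) := hD2.continuous_fderiv one_ne_zero
  have hgc : Continuous g := continuous_iff_continuousAt.2 fun s => (hg s).continuousAt
  have hr0 : 0 ≤ r := (Nat.cast_nonneg _).trans hr.le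
  have hM0 : 0 ≤ M := (hg'0 0).trans (hg'M 0)
  have hθd : ∀ x, HasFDerivAt θ (fderiv ℝ θ x) x := fun x =>
    (hθ2.differentiable two_ne_zero x).hasFDerivAt
  have hg1' : ∀ x, ‖g (θ x)‖ ≤ 1 := fun x => by
    rw [Real.norm_eq_abs]; exact hg1 _
  have hw0 : ∀ x : E, 0 ≤ C * (1 + ‖x‖) ^ (-r) := fun x =>
    mul_nonneg hC (Real.rpow_nonneg (by positivity) _)
  -- derivative of `y ↦ Dθ(y) bᵢ` and of `g ∘ θ`
  have hf : ∀ i x, HasFDerivAt (fun y => fderiv ℝ θ y (b i))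
      ((ContinuousLinearMap.apply ℝ ℝ (b i)).comp (fderiv ℝ (fderiv ℝ θ) x)) x :=
    fun i x => (ContinuousLinearMap.apply ℝ ℝ (b i)).hasFDerivAt.comp x
      (hD2.differentiable one_ne_zero x).hasFDerivAt
  have hG : ∀ x, HasFDerivAt (fun y => g (θ y)) (g' (θ x) • fderiv ℝ θ x) x :=
    fun x => (hg (θ x)).comp_hasFDerivAt x (hθd x)
  -- integrability of the three products
  have hI1 : ∀ i, Integrable (fun x => fderiv ℝ (fderiv ℝ θ) x (b i) (b i) * g (θ x))
      (volume : Measure E) := by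
    intro i
    refine integrable_of_norm_le_rpow_neg (C := C)
      (((hD2c.clm_apply continuous_const).clm_apply continuous_const).mul (hgc.comp hθc)) hr
      fun x => ?_
    rw [norm_mul]
    calc ‖fderiv ℝ (fderiv ℝ θ) x (b i) (b i)‖ * ‖g (θ x)‖ ≤ C * (1 + ‖x‖) ^ (-r) * 1 :=
          mul_le_mul (((norm_apply_orthonormalBasis_le b i _).trans
            (norm_apply_orthonormalBasis_le b i _)).trans (h2 x)) (hg1' x) (norm_nonneg _) (hw0 x)
      _ = C * (1 + ‖x‖) ^ (-r) := mul_one _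
  have hI2 : ∀ i, Integrable (fun x => fderiv ℝ θ x (b i) * ((g' (θ x) • fderiv ℝ θ x) (b i)))
      (volume : Measure E) := by
    intro i
    refine integrable_of_norm_le_decay_mul_decay (C₁ := C) (C₂ := M * C) (r' := r)
      ((hDθc.clm_apply continuous_const).mul
        (((hg'c.comp hθc).smul hDθc).clm_apply continuous_const)) hr hr0 hC (mul_nonneg hM0 hC)
      fun x => ?_
    rw [norm_mul, smul_apply, smul_eq_mul, norm_mul, mul_assoc M]
    refine mul_le_mul ((norm_apply_orthonormalBasis_le b i _).trans (h1 x))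
      (mul_le_mul ?_ ((norm_apply_orthonormalBasis_le b i _).trans (h1 x)) (norm_nonneg _) hM0)
      (by positivity) (hw0 x)
    rw [Real.norm_eq_abs, abs_of_nonneg (hg'0 _)]
    exact hg'M _
  have hI3 : ∀ i, Integrable (fun x => fderiv ℝ θ x (b i) * g (θ x)) (volume : Measure E) := by
    intro i
    refine integrable_of_norm_le_rpow_neg (C := C)
      ((hDθc.clm_apply continuous_const).mul (hgc.comp hθc)) hr fun x => ?_
    rw [norm_mul]
    calc ‖fderiv ℝ θ x (b i)‖ * ‖g (θ x)‖ ≤ C * (1 + ‖x‖) ^ (-r) * 1 :=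
          mul_le_mul ((norm_apply_orthonormalBasis_le b i _).trans (h1 x)) (hg1' x)
            (norm_nonneg _) (hw0 x)
      _ = C * (1 + ‖x‖) ^ (-r) := mul_one _
  -- integration by parts, one coordinate at a time
  have hibp : ∀ i, ∫ x, fderiv ℝ θ x (b i) * ((g' (θ x) • fderiv ℝ θ x) (b i)) =
      -∫ x, fderiv ℝ (fderiv ℝ θ) x (b i) (b i) * g (θ x) := by
    intro i
    have H := integral_bilinear_hasFDerivAt_right_eq_neg_left_of_integrable
      (μ := (volume : Measure E)) (f := fun y => fderiv ℝ θ y (b i))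
      (f' := fun x => (ContinuousLinearMap.apply ℝ ℝ (b i)).comp (fderiv ℝ (fderiv ℝ θ) x))
      (g := fun y => g (θ y)) (g' := fun x => g' (θ x) • fderiv ℝ θ x) (v := b i)
      (B := ContinuousLinearMap.mul ℝ ℝ)
      (hI1 i) (hI2 i) (hI3 i) (fun x _ => hf i x) (fun x _ => hG x)
    exact H
  calc ∫ x, g (θ x) * (Δ θ) x
      = ∫ x, ∑ i, fderiv ℝ (fderiv ℝ θ) x (b i) (b i) * g (θ x) := by
        refine integral_congr_ae (Eventually.of_forall fun x => ?_)
        simp only [laplacian_apply_eq_sum_fderiv_fderiv b, Finset.mul_sum]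
        exact Finset.sum_congr rfl fun i _ => mul_comm _ _
    _ = ∑ i, ∫ x, fderiv ℝ (fderiv ℝ θ) x (b i) (b i) * g (θ x) :=
        integral_finsetSum _ fun i _ => hI1 i
    _ = -∑ i, ∫ x, fderiv ℝ θ x (b i) * ((g' (θ x) • fderiv ℝ θ x) (b i)) := by
        rw [← Finset.sum_neg_distrib]
        refine Finset.sum_congr rfl fun i _ => ?_
        rw [hibp i, neg_neg]
    _ ≤ 0 := by
        rw [neg_nonpos]
        refine Finset.sum_nonneg fun i _ => integral_nonneg fun x => ?_
        show (0 : ℝ) ≤ _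
        rw [smul_apply, smul_eq_mul]
        calc (0 : ℝ) ≤ g' (θ x) * (fderiv ℝ θ x (b i) * fderiv ℝ θ x (b i)) :=
            mul_nonneg (hg'0 _) (mul_self_nonneg _)
          _ = _ := by ring

end General

end PassiveScalarL1

/-- **Tools sub-goal `kaux_transportPairingVanishes` (worker, stub K): the transport pairing
vanishes on `ℝ³`.** For a `C¹` divergence-free field `v ∈ L²(ℝ³)` (no decay of `v`) and a `C¹`
scalar `G` on `ℝ³` decaying with its derivative like `(1 + ‖x‖)^{-r}`, `3 < r`:
`∫ DG(x)(v x) dx = 0` (`PassiveScalarL1.integral_fderiv_apply_eq_zero_of_decay_of_memLp` on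
`EuclideanSpace ℝ (Fin 3)`, `finrank = 3`). Consumed (in its general form) by the proof of
`stub_passiveScalarL1Antitone`. -/
theorem kaux_transportPairingVanishes :
    ∀ (v : EuclideanSpace ℝ (Fin 3) → EuclideanSpace ℝ (Fin 3)) (G : EuclideanSpace ℝ (Fin 3) → ℝ),
      ContDiff ℝ 1 v → Literature.Analysis.FluidPDE.VectorCalculus.IsDivFree v →
      MeasureTheory.MemLp v 2 MeasureTheory.volume → ContDiff ℝ 1 G →
      ∀ (C r : ℝ), 0 ≤ C → 3 < r → (∀ x, ‖G x‖ ≤ C * (1 + ‖x‖) ^ (-r)) →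
      (∀ x, ‖fderiv ℝ G x‖ ≤ C * (1 + ‖x‖) ^ (-r)) → ∫ x, fderiv ℝ G x (v x) = 0 := by
  intro v G hv1 hdiv hv2 hG1 C r hC hr h0 h1
  exact PassiveScalarL1.integral_fderiv_apply_eq_zero_of_decay_of_memLp hv1 hdiv hv2 hG1 hC
    (by rw [finrank_euclideanSpace_fin]; exact_mod_cast hr) h0 h1

end Summit.NavierStokesRegularity.NavierStokesRegularity.Theorems
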